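import Summits.QuantumFields.YangMills.Theorems.UnitScaleTiltHalvingHSiteRowsOfSocketsTGammaR
import Summits.QuantumFields.YangMills.Theorems.UnitScaleTiltHalvingTopCrossingQkOfDefect
import Summits.QuantumFields.YangMills.Theorems.UnitScaleTiltHalvingTreeAxialStokes
import Summits.QuantumFields.YangMills.Theorems.UnitScaleTiltHalvingP1FlatCoreFrameLinTower
import Summits.QuantumFields.YangMills.Theorems.UnitScaleTiltHalvingHSiteTorusBlocks
import Summits.QuantumFields.YangMills.Theorems.UnitScaleTiltHalvingEffGaugeTowerRatioLocal
import Summits.QuantumFields.YangMills.Theorems.UnitScaleTiltHalvingEffGaugeRowGLabels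
import Summits.QuantumFields.YangMills.Theorems.UnitScaleTiltHalvingEffGaugeRowGUnitary
import HarnessLib

/-!
# Line H (`BirthV10.stub_halvingStep`, stmt-QuantumFields-19200) — (M2′) (b)-row: ★★★ (B-al-4)₃ — ROW `hG` OF THE B-al-3 DOOR (✓p696030) FROM THE TWO FIELD-SIDE ROWS
# (stair sizes of the torus double bar, their unitarity) AND THE ω-ROW (in-block oscillation of the averaged datum gauge `R̄ʲu₁`)

Cell `ym3-torus` (HUMAN RULING D-0037: YM₃ on T³ is ladder rung R3 — NOT d = 4, NOT infinite volume, NOT a mass gap, NOT the Clay problem).  STATEMENT (skeleton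
5eaab209f758160e, minus the idle binder `hM′`) by width seat `ym-ust-20520-w3` gen 9 (LEAD-H ★w5-19200 g7 WORD 21 «B-al-3 door + (B-al-4) = w3-20520 g9»); PROOF by width seat
`ym-ust-20520-w4` gen 11 (fallback pen after ★w3-20520 g9's ■ FINAL, his plan (P1)–(P10)) over the two letter files ✓`…HalvingEffGaugeRowGLabels` (label boxes, pyramid, no-wrap left
inverse of the level cover) and ✓`…HalvingEffGaugeRowGUnitary` ((78)∕(80) in the `exp[mean log]` letter, unitarity of `R̄ʲu₁`, the (P5)∕(P6)∕(P8) rows).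
`--supports stmt-QuantumFields-19200 --as helper`; THEOREMS ONLY (0 `def`, 0 `sorry`); count-neutral; nothing here claims B-al-2, (F-h), (F-ω), (M2′), the stub, the crux or
the gap — the three rows are HYPOTHESES.

WHAT.  ★★★`hG_of_rows` — conclusion = ✓p696030 `hStokes_of_rows`'s row `hG` VERBATIM.  Proof: the effective gauge `κ_j` of `û = (u₁ ∘ (lift x₀ + rel x₀ ·))⁻¹` down `X̂`'s
double-bar tower is compared on the PYRAMID `S_j := {π_j w | w ∈ Q_j}` (`Q_j` = the `L^{k−j}`-blow-up of the top label box `□_k^{(k)}` = the rows' `InBox … w` boxes) with the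
reference family `A_0 := κ_0`, `A_{j+1} := (uavg L 1 u₁ (j+1) ∘ lab_{j+1})⁻¹` for ANY left inverse `lab_j` of `π_j` on `Q_j` (✓`exists_leftInverse_coverAt`, no wrap by `hroomW`;
`lab_0 = lift x₀ + rel x₀ ·` on `Q_0` by ✓`lift_add_rel_cover_eq_of_inBox_zero`, so `A_j (π_j w) = R̄ʲu₁(w)⁻¹` for `w ∈ Q_j` at every `j`); the rows `hH`∕`hHU` of
✓`norm_effGauge_ratio_le_of_pyramid_local` are (F-h)∕(F-hU); `hosc` is the ω-row through ✓`norm_ratio_conj_sub_one_le` (`e_j := 3·ω_j`); `href` is the CORNER↔CENTRE base change of the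
`exp[mean log]` block average ✓`norm_href_sub_one_le` (`τ_j := 1200·ω_j²`); unitarity of `κ_j` on the pyramid is CARRIED (`G :=` the unitary units, ✓`effGaugeStep_mem_unitaryUnits`),
of `A_j` proved from the ω-row (✓`uavg_one_mem_unitaryUnits`); at the top (1.29) reads `uavg L 1 u₁ k = 1` on `Q_k = □_k^{(k)}` (lit ✓`restr129_iff_uavg`), so `‖κ_k − 1‖ ≤ E_k ≤ θG`
at `Bᵏx₀` (its label lies in `Q_k` by `ha`) and on the top cube.
HONEST SCOPE.  Bookkeeping + the base-change estimate; the level recursion `hE` is displayed (its closed form is px10 g4's ✓`HalvingBalLevelRecursion.tower_of_step_top`, the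
consumer's call); the three rows are supplied elsewhere (px3 g5's tower for (F-h)(F-hU), px9 g6's `HalvingOmegaRow` for (F-ω)).

References: T. Bałaban, CMP **98** (1985) 17–51 [Balaban1985Averaging] ((78)–(80) p.30, (84) p.30, (97)–(100) p.32, (110) p.34); CMP **99** (1985) 75–102 [Balaban1985RegularSpaces]
((1.29) p.81, (1.131) p.99); CMP **109** (1987) 249–301 [Balaban1987RG1] ((0.1) p.251, (0.4)–(0.8) p.253).
-/

set_option autoImplicit false

noncomputable section

namespace Summit.QuantumFields.YangMills.Theorems.HalvingEffGaugeRowG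

open scoped BigOperators Matrix.Norms.L2Operator
open NormedSpace  open Complex (I)


open Literature.MathematicalPhysics.QuantumFieldTheory.Balaban1983to89  open Literature.MathematicalPhysics.QuantumFieldTheory.Balaban1983to89.T3ContinuumYM3Torus
open Literature.MathematicalPhysics.QuantumFieldTheory.Balaban1983to89.T3PrintedRegularMinimiser (RegPr regFibrePr)  open MatrixLog (mlog)  open B5Eq118OneStroke (iterBlockOf)  open B7Prop1Explicit (e expUnit)  open B7Prop1Explicit renaming Site → LSite
open B7Prop2Explicit (unitaryUnits C0 c2' avgIter)  open B7Prop2SpecialUnitary (specialUnitaryUnits mem_specialUnitaryUnits specialUnitaryUnits_le_unitaryUnits)  open B7Prop3Flat (c3)  open B7Prop10General (C6 C4G)  open B7Prop9Flat (C5')  open B7Prop1Local (InBox loK bondHiK)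
open B7Eq78Linearization (conjR zdBlocking QprimeIter)  open B7Eq92Concrete (mgauge)  open B8Ineq130 (tlo thi)  open B8Ineq132 (covDerivFwd InAk)
open B8Eq119TwistedAxial (Restr129 InAx bgT)  open B8Eq131Cubes (cube gs tLo tHi)  open B8Eq131CubesAdmissible (cubeFam)  open B8CubeMemberZd (cubeLamS cubeLamB)  open B8Eq184Proof (gaugeExp cfgExp)  open B8Eq182Proof (gAd)  open B8Eq188Proof (frakF3)  open B8Eq140Level (SideTouches)
open B8Eq146AExpansion (iEta)  open B8Eq138LandauZd (IsLandau138W covDivB covLap QT logCfg)  open B7Prop4GeneralLevels (logCovIter linCovIter)  open B8Eq155JBound (Jcur wsup)  open B8ScaledSupNorm (bondNorm msup)  open B8Ineq125Concrete (C2p)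
open B8Eq1117Concrete (XSpace)  open B9SupplySockB9P3ZdBeta (CrossB)  open B9SupplySockB9P3ZdGamma (cubeLamBP')  open B8Ineq132 (BondTouches)
open HalvingHSiteDatumRowsGamma (datumRowsγ h66_of_towerRow betaScalarRows)  open B8Prop5ContractionKLevel (Bd2 Mc Kc)  open B8LambdaSpaceKLevel (wt)  open B8Eq178Averages (Qnl)  open B8SpecialUnitaryTrace (trCLM trCLM_apply)
open B10Eq27TorusAxialLog (transl rel pull pull_apply unitsField toUField suIncl gaugeActT axialT unitsField_mem_unitaryUnits)  open B15Eq112TorusCover (lift cover)  open Node00 (coverAt)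
open LatticeFieldCalculus (siteAvgIter)  open Summit.QuantumFields.YangMills.Theorems.Prop8ChartDoubleBar (dbarIterU vframeU)  open P1FlatCoreCubeInclusion (corner_of_offset)  open HalvingP1FlatCoreSupplierAssembly (hchartTop_of_hdat hc₁_of_small)
open HalvingHSiteSizeRowsOfTopRowsGamma (siteSizeRows_of_topRows_γ)  open HalvingHSiteTopKnit (hknit_of_descent)  open HalvingHSiteDatumOfSocketsTGammaTree (siteDatum_of_T4Tγ_tree)  open B8Lemma1NonAbelian (lowPart)  open HalvingHSiteTopH42OfRowsGammaD (H42_of_rows_γD)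
open HalvingHSiteTopKnitBP (hknit_of_descent_BP')  open B8CubeMemberZd (hΩ_cubeFam)  open B8SockHFPCubeMember (htw_cubeLamS h8lt_cubeLamS h8top_cubeLamS)  open B8Prop6OfThm4 (one_inAk)
open HalvingP1FlatCoreSupplierRestr129 (restr129_product_of_topRows)  open HalvingP1FlatCoreSupplierInduction (h34_of_inAk_univ hAx_of_inAx_one)  open B8Prop5SocketDatum (restr129_succ_of_truncation)  open P1FlatCoreTopH42Gamma (cubeLamB_top_subset_cubeLamBP')  open B7Prop4Flat (C2 c4)  open HalvingHSiteTopOfDatumGamma (siteTop_of_datum_γ)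

open B7Prop5Flat (BondIn)  open B7Prop1Local (AgreeOn)  open B7Eq92Concrete (tildIter tildIter_apply tHol)  open B7Eq84Concrete (uavg)
open B7Prop1Explicit (treeWord boxVec)  open B8Ineq132 (Under avgIter_one)  open B8Eq131Derivation (ax119_iff_ax67)  open B8Ineq172Concrete (tHol_block_congr)
open B8Eq142KLevelLocal (inBox_box_of_tower_fst inBox_box_of_tower_snd)  open B8CubeMemberLamBPrimeLaws (cubeLamBP'_hbox_pred cubeLamBP'_hclass)
open B8Eq131CubesAdmissible (cubeFam_false_of_le)  open B8CubeMemberZd (cubeLamS_self)  open B8Eq131Cubes (mem_cube_iff cube_anti)  open B8Eq140Level (sideTouches_of_bondTouches)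
open B7Prop1Local (avgIter_congr)  open B7Prop3Flat (expCfg)
open HalvingTopCrossingQkOfDefect (norm_logCovIter_succ_lt_crossing_of_defect_loc uavg_succ_eq_one_of_restr129_box agreeOn_of_subbox)
open HalvingHSiteTopRowsOfSocketsGamma (h135_cubeMember_γ)  open P1FlatCoreTopTargetRep (rep_cover_eq_of_mem_cube)  open HalvingP1FlatCoreSupplierGaugeDescent (gaugeActT_mul_left)
open HalvingCompetitorMapFibre (unitsField_toUField_gaugeAct)  open P1FlatCoreCubeInclusion (transl_zero_eq_cover)  open B10Eq27TorusAxialLog (transl_add_e)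
open B7Eq92Concrete (mgauge_apply Rc_one_apply)  open Summit.QuantumFields.YangMills.Theorems (FlatMinimizerH.le_T3)

open HalvingTreeAxialStokes (norm_axialFn_sub_one_le_of_treeAxial)
open B7Prop1Explicit (U1 mem_U1 hol hol_cons hol_nil stepHol stepHol_true stepHol_false Letter hol_mem norm_inv_sub_one_le axialFn l1)
open P1FlatCoreFrameLinTower (dbarIterU_gaugeActT_eq_effGauge)  open B10Eq27TorusAxialLog (gaugeActT_apply holT)  open Prop7AxialGauge (axialT_gaugeActT holT_gaugeActT)
open B7Prop7LinearBound (norm_units_inv_sub_one_le_two_mul)  open B10Eq27TorusAxialLog (axialFn_pull_rel transl_apply)  open B7Prop1Explicit (length_treeWord)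
open B8Eq131Cubes (sqLo sqHi bLo bHi)  open B8CubeMemberZd (inBox_sq_of_mem_cubeLamS)
open HalvingHSiteTorusBlocks (rel_coverAt_eq l1_rel_coverAt_le walk_treeWord_subset_territory coverAt_mem_territory two_mul_le_sitesPerDir_of_room)


open HalvingEffGaugeTowerRatioLocal (norm_effGauge_ratio_le_of_pyramid_local)  open T4Continuum (stairWord walkEnd)  open BlockAveraging (Idx off)  open ExpMeanLog (eml eml_eq_exp_sum eml_conj eml_inv_mul)
open B8Ineq130 (tlo_apply thi_apply)

open B7Eq84Concrete (bzero boxVec_bzero uavg_zero)  open B8Eq178Averages (restr129_iff_uavg)  open Node00 (coverAt_valLift)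

variable (F : T3Family) {n K : ℕ}

set_option maxHeartbeats 400000 in
/-- ★★★ **ROW `hG` OF THE B-al-3 DOOR FROM THE STAIR ROWS AND THE ω-ROW** — conclusion = ✓p696030 `hStokes_of_rows`'s hypothesis `hG` VERBATIM; rows `hStair` (F-h),
`hStairU` (F-hU), `hOsc` (F-ω, `uavg`-form) displayed under the binder's guards; numeric rows `hh0 hh1 hω0 hω1 hE0 hE1 hE hθG` (the level recursion with `e_j := 3ω_j`,
`τ_j := 1200ω_j²`). [cite: Balaban1985Averaging, (78)-(80) p.30, (97)-(100) p.32, (110) p.34; Balaban1985RegularSpaces, (1.29) p.81] -/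
theorem hG_of_rows (x₀ : Site (F.P K) 0) {a : LSite (F.P K).d} {M' ρ' : ℕ}
    (ha : ∀ ν, a ν ≤ ((iterBlockOf (K - n) x₀ ν).val : ℤ) ∧ ((iterBlockOf (K - n) x₀ ν).val : ℤ) ≤ a ν + M' - 1)
    (hroomW : 2 * ((F.P K).L ^ (K - n) * (M' + 1) + ρ' * gs (F.P K).L (K - n)) ≤ (F.P K).sitesPerDir 0)
    (U : GaugeField (F.P K) 0 (Matrix.specialUnitaryGroup (Fin 2) ℂ))
    {ε₀ s θG : ℝ} {hh ω E : ℕ → ℝ}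
    (hh0 : ∀ j, 0 ≤ hh j) (hh1 : ∀ j, hh j ≤ 1 / 64) (hω0 : ∀ j, 0 ≤ ω j) (hω1 : ∀ j, ω j ≤ 1 / 600)
    (hE0 : 0 ≤ E 0) (hE1 : ∀ j, j ≤ K - n → E j ≤ 1 / 200)
    (hE : ∀ j, j < K - n →
      E j + 160 * E j ^ 2 + 3300 * E j * (3 * ω j) + 5 * (1536 * hh j * (3 * ω j + 21 / 10 * E j)) + 4 * (1200 * ω j ^ 2) ≤ E (j + 1))
    (hθG : E (K - n) ≤ θG)
    -- ROW (F-h): the centre-stair transporters of `U̿^{(j)}X̂` at the pyramid's blocks are within `hh j` of `1`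
    (hStair : ∀ (gJ : GaugeTransf (F.P K) 0 (Matrix.specialUnitaryGroup (Fin 2) ℂ)) (u₁ : LSite (F.P K).d → (Matrix (Fin 2) (Fin 2) ℂ)ˣ)
        (W : LSite (F.P K).d → Fin (F.P K).d → (Matrix (Fin 2) (Fin 2) ℂ)ˣ) (A : LSite (F.P K).d → Fin (F.P K).d → Matrix (Fin 2) (Fin 2) ℂ) (c₁ c' : ℝ),
      InAk (F.P K).L (K - n) (((F.L : ℝ)⁻¹) ^ (K - n)) ε₀ (fun _ => (Set.univ : Set (LSite (F.P K).d))) (pull (unitsField (toUField (GaugeField.gaugeAct gJ U))) 0) →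
      (∀ m', m' ≤ K - n → ∀ Λ : ℕ → Set (LSite (F.P K).d), InAx (F.P K).L m' Λ (1 : LSite (F.P K).d → Fin (F.P K).d → (Matrix (Fin 2) (Fin 2) ℂ)ˣ) (pull (unitsField (toUField (GaugeField.gaugeAct gJ U))) 0)) →
      (∀ m', m' ≤ K - n → ∀ (x : LSite (F.P K).d) (ν : Fin (F.P K).d), tlo (F.P K).L (tLo a ρ') m' ≤ x → x + e ν ≤ thi (F.P K).L (tHi a M' ρ') m' →
        ‖((avgIter (F.P K).L (pull (unitsField (toUField (GaugeField.gaugeAct gJ U))) 0) (K - n - m') x ν : (Matrix (Fin 2) (Fin 2) ℂ)ˣ) : Matrix (Fin 2) (Fin 2) ℂ) - 1‖ < s) →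
      (∀ (x : LSite (F.P K).d) (ν : Fin (F.P K).d), tLo a ρ' ≤ x → x + e ν ≤ tHi a M' ρ' → lowPart ν (x - tLo a ρ') = 0 →
        avgIter (F.P K).L (pull (unitsField (toUField (GaugeField.gaugeAct gJ U))) 0) (K - n) x ν = 1) →
      (∀ z, ((u₁ z : (Matrix (Fin 2) (Fin 2) ℂ)ˣ) : Matrix (Fin 2) (Fin 2) ℂ) ∈ Matrix.specialUnitaryGroup (Fin 2) ℂ) →
      mgauge (1 : LSite (F.P K).d → Fin (F.P K).d → (Matrix (Fin 2) (Fin 2) ℂ)ˣ) u₁ W = pull (unitsField (toUField (GaugeField.gaugeAct gJ U))) 0 →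
      0 ≤ c' → 8 * 3800 * ((((F.P K).d + 2) * (F.P K).L : ℕ) : ℝ) ^ 2 * c' ≤ 1 → Real.exp c₁ - 1 ≤ ((F.L : ℝ)⁻¹) ^ (K - n) * c' →
      (∀ z ∈ cube (F.P K).L a M' ρ' (K - n) (K - n), ∀ ν : Fin (F.P K).d, W z ν = cfgExp (((F.L : ℝ)⁻¹) ^ (K - n)) A z ν ∧ ((F.L : ℝ)⁻¹) ^ (K - n) * ‖A z ν‖ ≤ c₁) →
      Restr129 (F.P K).L (K - n) (cubeLamS (F.P K).L a M' ρ' (K - n) (K - n)) (1 : LSite (F.P K).d → Fin (F.P K).d → (Matrix (Fin 2) (Fin 2) ℂ)ˣ) u₁ →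
      ∀ j, j < K - n → ∀ w : LSite (F.P K).d,
        InBox (tlo (F.P K).L (sqLo (F.P K).L a ρ' (K - n) (K - n)) (K - n - (j + 1))) (thi (F.P K).L (sqHi (F.P K).L a M' ρ' (K - n) (K - n)) (K - n - (j + 1))) w →
        ∀ i : Idx (F.P K), ‖((holT (dbarIterU j (unitsField (toUField (GaugeField.gaugeAct gJ U)))) (emb (coverAt (F.P K) (j + 1) w)) (stairWord i.2.1 (off i.1)) :
          (Matrix (Fin 2) (Fin 2) ℂ)ˣ) : Matrix (Fin 2) (Fin 2) ℂ) - 1‖ ≤ hh j)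
    -- ROW (F-hU): the same transporters are unitary
    (hStairU : ∀ (gJ : GaugeTransf (F.P K) 0 (Matrix.specialUnitaryGroup (Fin 2) ℂ)) (u₁ : LSite (F.P K).d → (Matrix (Fin 2) (Fin 2) ℂ)ˣ)
        (W : LSite (F.P K).d → Fin (F.P K).d → (Matrix (Fin 2) (Fin 2) ℂ)ˣ) (A : LSite (F.P K).d → Fin (F.P K).d → Matrix (Fin 2) (Fin 2) ℂ) (c₁ c' : ℝ),
      InAk (F.P K).L (K - n) (((F.L : ℝ)⁻¹) ^ (K - n)) ε₀ (fun _ => (Set.univ : Set (LSite (F.P K).d))) (pull (unitsField (toUField (GaugeField.gaugeAct gJ U))) 0) →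
      (∀ m', m' ≤ K - n → ∀ Λ : ℕ → Set (LSite (F.P K).d), InAx (F.P K).L m' Λ (1 : LSite (F.P K).d → Fin (F.P K).d → (Matrix (Fin 2) (Fin 2) ℂ)ˣ) (pull (unitsField (toUField (GaugeField.gaugeAct gJ U))) 0)) →
      (∀ m', m' ≤ K - n → ∀ (x : LSite (F.P K).d) (ν : Fin (F.P K).d), tlo (F.P K).L (tLo a ρ') m' ≤ x → x + e ν ≤ thi (F.P K).L (tHi a M' ρ') m' →
        ‖((avgIter (F.P K).L (pull (unitsField (toUField (GaugeField.gaugeAct gJ U))) 0) (K - n - m') x ν : (Matrix (Fin 2) (Fin 2) ℂ)ˣ) : Matrix (Fin 2) (Fin 2) ℂ) - 1‖ < s) →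
      (∀ (x : LSite (F.P K).d) (ν : Fin (F.P K).d), tLo a ρ' ≤ x → x + e ν ≤ tHi a M' ρ' → lowPart ν (x - tLo a ρ') = 0 →
        avgIter (F.P K).L (pull (unitsField (toUField (GaugeField.gaugeAct gJ U))) 0) (K - n) x ν = 1) →
      (∀ z, ((u₁ z : (Matrix (Fin 2) (Fin 2) ℂ)ˣ) : Matrix (Fin 2) (Fin 2) ℂ) ∈ Matrix.specialUnitaryGroup (Fin 2) ℂ) →
      mgauge (1 : LSite (F.P K).d → Fin (F.P K).d → (Matrix (Fin 2) (Fin 2) ℂ)ˣ) u₁ W = pull (unitsField (toUField (GaugeField.gaugeAct gJ U))) 0 →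
      0 ≤ c' → 8 * 3800 * ((((F.P K).d + 2) * (F.P K).L : ℕ) : ℝ) ^ 2 * c' ≤ 1 → Real.exp c₁ - 1 ≤ ((F.L : ℝ)⁻¹) ^ (K - n) * c' →
      (∀ z ∈ cube (F.P K).L a M' ρ' (K - n) (K - n), ∀ ν : Fin (F.P K).d, W z ν = cfgExp (((F.L : ℝ)⁻¹) ^ (K - n)) A z ν ∧ ((F.L : ℝ)⁻¹) ^ (K - n) * ‖A z ν‖ ≤ c₁) →
      Restr129 (F.P K).L (K - n) (cubeLamS (F.P K).L a M' ρ' (K - n) (K - n)) (1 : LSite (F.P K).d → Fin (F.P K).d → (Matrix (Fin 2) (Fin 2) ℂ)ˣ) u₁ →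
      ∀ j, j < K - n → ∀ w : LSite (F.P K).d,
        InBox (tlo (F.P K).L (sqLo (F.P K).L a ρ' (K - n) (K - n)) (K - n - (j + 1))) (thi (F.P K).L (sqHi (F.P K).L a M' ρ' (K - n) (K - n)) (K - n - (j + 1))) w →
        ∀ i : Idx (F.P K), ((holT (dbarIterU j (unitsField (toUField (GaugeField.gaugeAct gJ U)))) (emb (coverAt (F.P K) (j + 1) w)) (stairWord i.2.1 (off i.1)) :
          (Matrix (Fin 2) (Fin 2) ℂ)ˣ) : Matrix (Fin 2) (Fin 2) ℂ) ∈ Matrix.unitaryGroup (Fin 2) ℂ)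
    -- ROW (F-ω): in-block oscillation of the averaged datum gauge `R̄ʲu₁ = uavg L 1 u₁ j` (corner-based) on the pyramid's blocks
    (hOsc : ∀ (gJ : GaugeTransf (F.P K) 0 (Matrix.specialUnitaryGroup (Fin 2) ℂ)) (u₁ : LSite (F.P K).d → (Matrix (Fin 2) (Fin 2) ℂ)ˣ)
        (W : LSite (F.P K).d → Fin (F.P K).d → (Matrix (Fin 2) (Fin 2) ℂ)ˣ) (A : LSite (F.P K).d → Fin (F.P K).d → Matrix (Fin 2) (Fin 2) ℂ) (c₁ c' : ℝ),
      InAk (F.P K).L (K - n) (((F.L : ℝ)⁻¹) ^ (K - n)) ε₀ (fun _ => (Set.univ : Set (LSite (F.P K).d))) (pull (unitsField (toUField (GaugeField.gaugeAct gJ U))) 0) →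
      (∀ m', m' ≤ K - n → ∀ Λ : ℕ → Set (LSite (F.P K).d), InAx (F.P K).L m' Λ (1 : LSite (F.P K).d → Fin (F.P K).d → (Matrix (Fin 2) (Fin 2) ℂ)ˣ) (pull (unitsField (toUField (GaugeField.gaugeAct gJ U))) 0)) →
      (∀ m', m' ≤ K - n → ∀ (x : LSite (F.P K).d) (ν : Fin (F.P K).d), tlo (F.P K).L (tLo a ρ') m' ≤ x → x + e ν ≤ thi (F.P K).L (tHi a M' ρ') m' →
        ‖((avgIter (F.P K).L (pull (unitsField (toUField (GaugeField.gaugeAct gJ U))) 0) (K - n - m') x ν : (Matrix (Fin 2) (Fin 2) ℂ)ˣ) : Matrix (Fin 2) (Fin 2) ℂ) - 1‖ < s) →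
      (∀ (x : LSite (F.P K).d) (ν : Fin (F.P K).d), tLo a ρ' ≤ x → x + e ν ≤ tHi a M' ρ' → lowPart ν (x - tLo a ρ') = 0 →
        avgIter (F.P K).L (pull (unitsField (toUField (GaugeField.gaugeAct gJ U))) 0) (K - n) x ν = 1) →
      (∀ z, ((u₁ z : (Matrix (Fin 2) (Fin 2) ℂ)ˣ) : Matrix (Fin 2) (Fin 2) ℂ) ∈ Matrix.specialUnitaryGroup (Fin 2) ℂ) →
      mgauge (1 : LSite (F.P K).d → Fin (F.P K).d → (Matrix (Fin 2) (Fin 2) ℂ)ˣ) u₁ W = pull (unitsField (toUField (GaugeField.gaugeAct gJ U))) 0 →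
      0 ≤ c' → 8 * 3800 * ((((F.P K).d + 2) * (F.P K).L : ℕ) : ℝ) ^ 2 * c' ≤ 1 → Real.exp c₁ - 1 ≤ ((F.L : ℝ)⁻¹) ^ (K - n) * c' →
      (∀ z ∈ cube (F.P K).L a M' ρ' (K - n) (K - n), ∀ ν : Fin (F.P K).d, W z ν = cfgExp (((F.L : ℝ)⁻¹) ^ (K - n)) A z ν ∧ ((F.L : ℝ)⁻¹) ^ (K - n) * ‖A z ν‖ ≤ c₁) →
      Restr129 (F.P K).L (K - n) (cubeLamS (F.P K).L a M' ρ' (K - n) (K - n)) (1 : LSite (F.P K).d → Fin (F.P K).d → (Matrix (Fin 2) (Fin 2) ℂ)ˣ) u₁ →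
      ∀ j, j < K - n → ∀ c : LSite (F.P K).d,
        InBox (tlo (F.P K).L (sqLo (F.P K).L a ρ' (K - n) (K - n)) (K - n - (j + 1))) (thi (F.P K).L (sqHi (F.P K).L a M' ρ' (K - n) (K - n)) (K - n - (j + 1))) c →
        ∀ r : Fin (F.P K).d → Fin (F.P K).L,
          ‖((((uavg (F.P K).L (1 : LSite (F.P K).d → Fin (F.P K).d → (Matrix (Fin 2) (Fin 2) ℂ)ˣ) u₁ j (((F.P K).L : ℤ) • c))⁻¹ *
              uavg (F.P K).L (1 : LSite (F.P K).d → Fin (F.P K).d → (Matrix (Fin 2) (Fin 2) ℂ)ˣ) u₁ j (((F.P K).L : ℤ) • c + boxVec (F.P K).L r)) :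
            (Matrix (Fin 2) (Fin 2) ℂ)ˣ) : Matrix (Fin 2) (Fin 2) ℂ) - 1‖ ≤ ω j) :
    ∀ (gJ : GaugeTransf (F.P K) 0 (Matrix.specialUnitaryGroup (Fin 2) ℂ)) (u₁ : LSite (F.P K).d → (Matrix (Fin 2) (Fin 2) ℂ)ˣ)
        (W : LSite (F.P K).d → Fin (F.P K).d → (Matrix (Fin 2) (Fin 2) ℂ)ˣ) (A : LSite (F.P K).d → Fin (F.P K).d → Matrix (Fin 2) (Fin 2) ℂ) (c₁ c' : ℝ),
      InAk (F.P K).L (K - n) (((F.L : ℝ)⁻¹) ^ (K - n)) ε₀ (fun _ => (Set.univ : Set (LSite (F.P K).d))) (pull (unitsField (toUField (GaugeField.gaugeAct gJ U))) 0) →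
      (∀ m', m' ≤ K - n → ∀ Λ : ℕ → Set (LSite (F.P K).d), InAx (F.P K).L m' Λ (1 : LSite (F.P K).d → Fin (F.P K).d → (Matrix (Fin 2) (Fin 2) ℂ)ˣ) (pull (unitsField (toUField (GaugeField.gaugeAct gJ U))) 0)) →
      (∀ m', m' ≤ K - n → ∀ (x : LSite (F.P K).d) (ν : Fin (F.P K).d), tlo (F.P K).L (tLo a ρ') m' ≤ x → x + e ν ≤ thi (F.P K).L (tHi a M' ρ') m' →
        ‖((avgIter (F.P K).L (pull (unitsField (toUField (GaugeField.gaugeAct gJ U))) 0) (K - n - m') x ν : (Matrix (Fin 2) (Fin 2) ℂ)ˣ) : Matrix (Fin 2) (Fin 2) ℂ) - 1‖ < s) →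
      (∀ (x : LSite (F.P K).d) (ν : Fin (F.P K).d), tLo a ρ' ≤ x → x + e ν ≤ tHi a M' ρ' → lowPart ν (x - tLo a ρ') = 0 →
        avgIter (F.P K).L (pull (unitsField (toUField (GaugeField.gaugeAct gJ U))) 0) (K - n) x ν = 1) →
      (∀ z, ((u₁ z : (Matrix (Fin 2) (Fin 2) ℂ)ˣ) : Matrix (Fin 2) (Fin 2) ℂ) ∈ Matrix.specialUnitaryGroup (Fin 2) ℂ) →
      mgauge (1 : LSite (F.P K).d → Fin (F.P K).d → (Matrix (Fin 2) (Fin 2) ℂ)ˣ) u₁ W = pull (unitsField (toUField (GaugeField.gaugeAct gJ U))) 0 →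
      0 ≤ c' → 8 * 3800 * ((((F.P K).d + 2) * (F.P K).L : ℕ) : ℝ) ^ 2 * c' ≤ 1 → Real.exp c₁ - 1 ≤ ((F.L : ℝ)⁻¹) ^ (K - n) * c' →
      (∀ z ∈ cube (F.P K).L a M' ρ' (K - n) (K - n), ∀ ν : Fin (F.P K).d, W z ν = cfgExp (((F.L : ℝ)⁻¹) ^ (K - n)) A z ν ∧ ((F.L : ℝ)⁻¹) ^ (K - n) * ‖A z ν‖ ≤ c₁) →
      Restr129 (F.P K).L (K - n) (cubeLamS (F.P K).L a M' ρ' (K - n) (K - n)) (1 : LSite (F.P K).d → Fin (F.P K).d → (Matrix (Fin 2) (Fin 2) ℂ)ˣ) u₁ →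
      ∀ (κ : (i : ℕ) → GaugeTransf (F.P K) i (Matrix (Fin 2) (Fin 2) ℂ)ˣ),
        (κ 0 = fun s => (u₁ (lift (F.P K) x₀ + rel x₀ s))⁻¹) →
        (∀ (i : ℕ) (y : Site (F.P K) (i + 1)),
          κ (i + 1) y = (vframeU (gaugeActT (κ i) (dbarIterU i (unitsField (toUField (GaugeField.gaugeAct gJ U))))) y)⁻¹ * κ i (emb y) * vframeU (dbarIterU i (unitsField (toUField (GaugeField.gaugeAct gJ U)))) y) →
        ‖((κ (K - n) (iterBlockOf (K - n) x₀) : (Matrix (Fin 2) (Fin 2) ℂ)ˣ) : (Matrix (Fin 2) (Fin 2) ℂ)) - 1‖ ≤ θG ∧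
        ∀ yc ∈ cubeLamS (F.P K).L a M' ρ' (K - n) (K - n) (K - n), ‖((κ (K - n) (coverAt (F.P K) (K - n) yc) : (Matrix (Fin 2) (Fin 2) ℂ)ˣ) : (Matrix (Fin 2) (Fin 2) ℂ)) - 1‖ ≤ θG := by
  intro gJ u₁ W A c₁ c' hInAk hInAx h137 h129 hSU hR1 hc'0 hwin hexp hchart hRestr κ hκ0 hκs
  classical
  -- ## letters
  have hkT : K - n ≤ (F.P K).m + (F.P K).K := FlatMinimizerH.le_T3 F n K
  have hLpos : 0 < (F.P K).L := (F.P K).L_pos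
  have hL1 : 1 ≤ (F.P K).L := hLpos
  -- the label boxes `Q_j` and their blow-up closure
  obtain ⟨Q, hQ⟩ : ∃ Q : ℕ → LSite (F.P K).d → Prop, ∀ j w, Q j w ↔
      InBox (tlo (F.P K).L (sqLo (F.P K).L a ρ' (K - n) (K - n)) (K - n - j)) (thi (F.P K).L (sqHi (F.P K).L a M' ρ' (K - n) (K - n)) (K - n - j)) w :=
    ⟨fun j w => InBox (tlo (F.P K).L (sqLo (F.P K).L a ρ' (K - n) (K - n)) (K - n - j)) (thi (F.P K).L (sqHi (F.P K).L a M' ρ' (K - n) (K - n)) (K - n - j)) w,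
      fun _ _ => Iff.rfl⟩
  have hQblow : ∀ j, j < K - n → ∀ w, Q (j + 1) w → ∀ r : Fin (F.P K).d → Fin (F.P K).L, Q j (((F.P K).L : ℤ) • w + boxVec (F.P K).L r) := by
    intro j hj w hw r
    have h := HalvingEffGaugeRowGLabels.inBox_blowup ((hQ (j + 1) w).1 hw) r
    rw [show K - n - (j + 1) + 1 = K - n - j by omega] at h
    exact (hQ j _).2 h
  have hQcentre : ∀ j, j < K - n → ∀ w, Q (j + 1) w → Q j (((F.P K).L : ℤ) • w) := by
    intro j hj w hw
    have h := hQblow j hj w hw (bzero hL1)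
    rwa [boxVec_bzero, add_zero] at h
  have hroomj : ∀ j, j ≤ K - n → ∀ μ, thi (F.P K).L (sqHi (F.P K).L a M' ρ' (K - n) (K - n)) (K - n - j) μ -
      tlo (F.P K).L (sqLo (F.P K).L a ρ' (K - n) (K - n)) (K - n - j) μ < ((F.P K).sitesPerDir j : ℤ) :=
    fun j hj μ => HalvingEffGaugeRowGLabels.width_lt_sitesPerDir_of_room hkT hj a hroomW μ
  -- a left inverse of `π_j` on `Q_j`, every level
  have hlabEx : ∀ j, ∃ lab : Site (F.P K) j → LSite (F.P K).d, j ≤ K - n → ∀ w, Q j w → lab (coverAt (F.P K) j w) = w := by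
    intro j
    by_cases hj : j ≤ K - n
    · obtain ⟨lab, hlab⟩ := HalvingEffGaugeRowGLabels.exists_leftInverse_coverAt (P := F.P K) (j := j) (hroomj j hj)
      exact ⟨lab, fun _ w hw => hlab w ((hQ j w).1 hw)⟩
    · exact ⟨fun _ => 0, fun h => absurd h hj⟩
  choose lab hlab using hlabEx
  -- the reference family: `A 0 = κ 0`, `A (j+1) = (R̄^{j+1}u₁ ∘ lab_{j+1})⁻¹`
  obtain ⟨Aref, hA0, hAS⟩ : ∃ Aref : (j : ℕ) → Site (F.P K) j → (Matrix (Fin 2) (Fin 2) ℂ)ˣ,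
      (∀ x, Aref 0 x = (u₁ (lift (F.P K) x₀ + rel x₀ x))⁻¹) ∧
      (∀ j x, Aref (j + 1) x = (uavg (F.P K).L (1 : LSite (F.P K).d → Fin (F.P K).d → (Matrix (Fin 2) (Fin 2) ℂ)ˣ) u₁ (j + 1) (lab (j + 1) x))⁻¹) :=
    ⟨fun j => match j with
      | 0 => fun x => (u₁ (lift (F.P K) x₀ + rel x₀ x))⁻¹
      | j + 1 => fun x => (uavg (F.P K).L (1 : LSite (F.P K).d → Fin (F.P K).d → (Matrix (Fin 2) (Fin 2) ℂ)ˣ) u₁ (j + 1) (lab (j + 1) x))⁻¹,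
      fun _ => rfl, fun _ _ => rfl⟩
  have hAlab : ∀ j, j ≤ K - n → ∀ w, Q j w →
      Aref j (coverAt (F.P K) j w) = (uavg (F.P K).L (1 : LSite (F.P K).d → Fin (F.P K).d → (Matrix (Fin 2) (Fin 2) ℂ)ˣ) u₁ j w)⁻¹ := by
    intro j hj w hw
    cases j with
    | zero =>
      rw [hA0, uavg_zero, HalvingEffGaugeRowGLabels.coverAt_zero_apply,
        HalvingEffGaugeRowGLabels.lift_add_rel_cover_eq_of_inBox_zero hkT x₀ ha hroomW ((hQ 0 w).1 hw)]
    | succ j => rw [hAS, hlab (j + 1) hj w hw]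
  -- unitarity letters
  have hu₁U : ∀ z, u₁ z ∈ unitaryUnits (Matrix (Fin 2) (Fin 2) ℂ) := fun z => (Matrix.mem_specialUnitaryGroup_iff.1 (hSU z)).1
  have hUinv : ∀ {x : (Matrix (Fin 2) (Fin 2) ℂ)ˣ}, x ∈ unitaryUnits (Matrix (Fin 2) (Fin 2) ℂ) → x⁻¹ ∈ unitaryUnits (Matrix (Fin 2) (Fin 2) ℂ) :=
    fun h => (unitaryUnits (Matrix (Fin 2) (Fin 2) ℂ)).inv_mem h
  have hUmul : ∀ {x y : (Matrix (Fin 2) (Fin 2) ℂ)ˣ}, x ∈ unitaryUnits (Matrix (Fin 2) (Fin 2) ℂ) → y ∈ unitaryUnits (Matrix (Fin 2) (Fin 2) ℂ) →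
      x * y ∈ unitaryUnits (Matrix (Fin 2) (Fin 2) ℂ) := fun hx hy => (unitaryUnits (Matrix (Fin 2) (Fin 2) ℂ)).mul_mem hx hy
  have hU1 : ∀ {x : (Matrix (Fin 2) (Fin 2) ℂ)ˣ}, x ∈ unitaryUnits (Matrix (Fin 2) (Fin 2) ℂ) → x ∈ U1 (Matrix (Fin 2) (Fin 2) ℂ) :=
    fun h => ⟨(CStarRing.norm_of_mem_unitary h).le, (CStarRing.norm_of_mem_unitary (hUinv h)).le⟩
  -- consumer forms of (P5)/(P6) over VARIABLES (so that the member instances below unify syntactically)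
  have hP5 : ∀ (V X Y : (Matrix (Fin 2) (Fin 2) ℂ)ˣ), V ∈ unitaryUnits (Matrix (Fin 2) (Fin 2) ℂ) → Y ∈ unitaryUnits (Matrix (Fin 2) (Fin 2) ℂ) →
      ‖(((X * Y⁻¹ : (Matrix (Fin 2) (Fin 2) ℂ)ˣ)) : Matrix (Fin 2) (Fin 2) ℂ) - 1‖ ≤
        ‖(((V⁻¹ * X : (Matrix (Fin 2) (Fin 2) ℂ)ˣ)) : Matrix (Fin 2) (Fin 2) ℂ) - 1‖ + ‖(((V⁻¹ * Y : (Matrix (Fin 2) (Fin 2) ℂ)ˣ)) : Matrix (Fin 2) (Fin 2) ℂ) - 1‖ := by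
    intro V X Y hV hY
    have h := HalvingEffGaugeRowGUnitary.norm_ratio_conj_sub_one_le (v := V) (g := V⁻¹ * Y) (V⁻¹ * X) hV (hUmul (hUinv hV) hY)
    rwa [mul_inv_cancel_left, mul_inv_cancel_left] at h
  have hP6 : ∀ (V₁ V X : (Matrix (Fin 2) (Fin 2) ℂ)ˣ) (Y : (Fin (F.P K).d → Fin (F.P K).L) → (Matrix (Fin 2) (Fin 2) ℂ)ˣ) (t : ℝ),
      ((V₁ : (Matrix (Fin 2) (Fin 2) ℂ)ˣ) : Matrix (Fin 2) (Fin 2) ℂ) = ((V : (Matrix (Fin 2) (Fin 2) ℂ)ˣ) : Matrix (Fin 2) (Fin 2) ℂ) *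
          eml (fun r => ((((V⁻¹ * Y r) : (Matrix (Fin 2) (Fin 2) ℂ)ˣ)) : Matrix (Fin 2) (Fin 2) ℂ)) →
      V ∈ unitaryUnits (Matrix (Fin 2) (Fin 2) ℂ) → X ∈ unitaryUnits (Matrix (Fin 2) (Fin 2) ℂ) → (∀ r, Y r ∈ unitaryUnits (Matrix (Fin 2) (Fin 2) ℂ)) →
      0 ≤ t → t ≤ 1 / 32 → ‖(((V⁻¹ * X : (Matrix (Fin 2) (Fin 2) ℂ)ˣ)) : Matrix (Fin 2) (Fin 2) ℂ) - 1‖ ≤ t →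
      (∀ r, ‖(((V⁻¹ * Y r : (Matrix (Fin 2) (Fin 2) ℂ)ˣ)) : Matrix (Fin 2) (Fin 2) ℂ) - 1‖ ≤ t) →
      ‖(((V₁ * X⁻¹ : (Matrix (Fin 2) (Fin 2) ℂ)ˣ)) : Matrix (Fin 2) (Fin 2) ℂ) *
          eml (fun i : Idx (F.P K) => (((X * (Y i.1)⁻¹ : (Matrix (Fin 2) (Fin 2) ℂ)ˣ)) : Matrix (Fin 2) (Fin 2) ℂ)) - 1‖ ≤ 1024 * t ^ 2 := by
    intro V₁ V X Y t hV₁ hV hX hY ht0 ht1 hXt hYt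
    have h := HalvingEffGaugeRowGUnitary.norm_href_sub_one_le (P := F.P K) V₁ V (V⁻¹ * X) (fun r => V⁻¹ * Y r) hV₁ hV (hUmul (hUinv hV) hX)
      (fun r => hUmul (hUinv hV) (hY r)) ht0 ht1 hXt hYt
      (HalvingEffGaugeRowGLabels.eml_idx_fst (P := F.P K)
        (fun r : Fin (F.P K).d → Fin (F.P K).L => (((V * (V⁻¹ * X)) * (V * (V⁻¹ * Y r))⁻¹ : (Matrix (Fin 2) (Fin 2) ℂ)ˣ) : Matrix (Fin 2) (Fin 2) ℂ)))
    simp only [mul_inv_cancel_left] at h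
    exact h
  have hOscω : ∀ j, j < K - n → ∀ w, Q (j + 1) w → ∀ r : Fin (F.P K).d → Fin (F.P K).L,
      ‖((((uavg (F.P K).L (1 : LSite (F.P K).d → Fin (F.P K).d → (Matrix (Fin 2) (Fin 2) ℂ)ˣ) u₁ j (((F.P K).L : ℤ) • w))⁻¹ *
          uavg (F.P K).L (1 : LSite (F.P K).d → Fin (F.P K).d → (Matrix (Fin 2) (Fin 2) ℂ)ˣ) u₁ j (((F.P K).L : ℤ) • w + boxVec (F.P K).L r)) :
        (Matrix (Fin 2) (Fin 2) ℂ)ˣ) : Matrix (Fin 2) (Fin 2) ℂ) - 1‖ ≤ ω j :=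
    fun j hj w hw r => hOsc gJ u₁ W A c₁ c' hInAk hInAx h137 h129 hSU hR1 hc'0 hwin hexp hchart hRestr j hj w ((hQ (j + 1) w).1 hw) r
  have hvU : ∀ j, j ≤ K - n → ∀ w, Q j w →
      uavg (F.P K).L (1 : LSite (F.P K).d → Fin (F.P K).d → (Matrix (Fin 2) (Fin 2) ℂ)ˣ) u₁ j w ∈ unitaryUnits (Matrix (Fin 2) (Fin 2) ℂ) :=
    HalvingEffGaugeRowGUnitary.uavg_one_mem_unitaryUnits hLpos u₁ hu₁U Q hQblow
      (fun j hj w hw r => (hOscω j hj w hw r).trans ((hω1 j).trans (by norm_num)))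
  -- the top: `R̄ᵏu₁ = 1` on `Q_k` by (1.29)
  have htop : ∀ w, Q (K - n) w →
      uavg (F.P K).L (1 : LSite (F.P K).d → Fin (F.P K).d → (Matrix (Fin 2) (Fin 2) ℂ)ˣ) u₁ (K - n) w = 1 := by
    intro w hw
    have hw' : w ∈ cubeLamS (F.P K).L a M' ρ' (K - n) (K - n) (K - n) := by
      rw [← HalvingEffGaugeRowGLabels.inBox_top_iff_mem_cubeLamS]
      have h := (hQ (K - n) w).1 hw
      rwa [Nat.sub_self] at h
    exact (restr129_iff_uavg _ _ _ _ _).1 hRestr (K - n) le_rfl w hw'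
  -- ## the pyramid induction
  have hmain := HalvingEffGaugeTowerRatioLocal.norm_effGauge_ratio_le_of_pyramid_local (P := F.P K) (𝔸 := Matrix (Fin 2) (Fin 2) ℂ)
    (unitsField (toUField (GaugeField.gaugeAct gJ U))) κ Aref hκs (k := K - n)
    (fun j => {x | ∃ w, Q j w ∧ x = coverAt (F.P K) j w})
    (by -- hS
      rintro j hj y ⟨w, hw, rfl⟩
      refine ⟨⟨((F.P K).L : ℤ) • w + boxVec (F.P K).L (fun _ => ⟨((F.P K).L - 1) / 2, AveragingRT.half_lt (F.P K)⟩), hQblow j hj w hw _, ?_⟩,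
        fun i => ⟨((F.P K).L : ℤ) • w + boxVec (F.P K).L i.1, hQblow j hj w hw _, ?_⟩⟩
      · exact HalvingEffGaugeRowGLabels.emb_coverAt_eq_boxVec (by omega) w
      · exact HalvingEffGaugeRowGLabels.walkEnd_emb_stairWord_coverAt (by omega) w i)
    (unitaryUnits (Matrix (Fin 2) (Fin 2) ℂ) : Set (Matrix (Fin 2) (Fin 2) ℂ)ˣ) (fun u hu => hU1 hu)
    (by -- hAU
      rintro j hj x ⟨w, hw, rfl⟩
      rw [hAlab j hj w hw]
      exact hU1 (hUinv (hvU j hj w hw)))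
    (by -- hHU
      rintro j hj y ⟨w, hw, rfl⟩ i
      exact hU1 (hStairU gJ u₁ W A c₁ c' hInAk hInAx h137 h129 hSU hR1 hc'0 hwin hexp hchart hRestr j hj w ((hQ (j + 1) w).1 hw) i))
    hh (fun j => 3 * ω j) (fun j => 1200 * ω j ^ 2) E hh0 hh1
    (fun j => by have := hω0 j; positivity)
    (fun j => by have := hω1 j; linarith)
    (fun j => by have := hω0 j; have := hω1 j; nlinarith)
    hE1
    (by -- hH
      rintro j hj y ⟨w, hw, rfl⟩ i
      exact hStair gJ u₁ W A c₁ c' hInAk hInAx h137 h129 hSU hR1 hc'0 hwin hexp hchart hRestr j hj w ((hQ (j + 1) w).1 hw) i)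
    (by -- hosc
      rintro j hj y ⟨w, hw, rfl⟩ i
      have hj1 : j + 1 ≤ (F.P K).m + (F.P K).K := by omega
      rw [HalvingEffGaugeRowGLabels.walkEnd_emb_stairWord_coverAt hj1 w i, HalvingEffGaugeRowGLabels.emb_coverAt_eq_boxVec hj1 w,
        hAlab j hj.le _ (hQblow j hj w hw _), hAlab j hj.le _ (hQblow j hj w hw _), inv_inv]
      refine (hP5 _ _ _ (hvU j hj.le _ (hQcentre j hj w hw)) (hvU j hj.le _ (hQblow j hj w hw _))).trans ?_
      have h1 := hOscω j hj w hw (fun _ => ⟨((F.P K).L - 1) / 2, AveragingRT.half_lt (F.P K)⟩)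
      have h2 := hOscω j hj w hw i.1
      have := hω0 j
      linarith)
    (by -- href
      rintro j hj y ⟨w, hw, rfl⟩
      have hj1 : j + 1 ≤ (F.P K).m + (F.P K).K := by omega
      rw [hAlab (j + 1) hj w hw, inv_inv]
      simp only [HalvingEffGaugeRowGLabels.walkEnd_emb_stairWord_coverAt hj1 w]
      rw [HalvingEffGaugeRowGLabels.emb_coverAt_eq_boxVec hj1 w, hAlab j hj.le _ (hQblow j hj w hw _), inv_inv]
      have hx : ∀ i : Idx (F.P K), Aref j (coverAt (F.P K) j (((F.P K).L : ℤ) • w + boxVec (F.P K).L i.1)) =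
          (uavg (F.P K).L (1 : LSite (F.P K).d → Fin (F.P K).d → (Matrix (Fin 2) (Fin 2) ℂ)ˣ) u₁ j (((F.P K).L : ℤ) • w + boxVec (F.P K).L i.1))⁻¹ :=
        fun i => hAlab j hj.le _ (hQblow j hj w hw _)
      simp only [hx]
      refine (hP6 _ _ _ (fun r => uavg (F.P K).L (1 : LSite (F.P K).d → Fin (F.P K).d → (Matrix (Fin 2) (Fin 2) ℂ)ˣ) u₁ j (((F.P K).L : ℤ) • w + boxVec (F.P K).L r))
        (ω j) (HalvingEffGaugeRowGUnitary.val_uavg_one_succ _ _ _ _) (hvU j hj.le _ (hQcentre j hj w hw)) (hvU j hj.le _ (hQblow j hj w hw _))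
        (fun r => hvU j hj.le _ (hQblow j hj w hw _)) (hω0 j) ((hω1 j).trans (by norm_num)) (hOscω j hj w hw _) (fun r => hOscω j hj w hw r)).trans ?_
      have := hω0 j
      nlinarith)
    (by -- hκ0G
      intro x _
      rw [congrFun hκ0 x]
      exact (unitaryUnits _).inv_mem (hu₁U _))
    (by -- hκsG
      rintro j hj y ⟨w, hw, rfl⟩ hc hi hosc
      rw [hκs]
      refine HalvingEffGaugeRowGUnitary.effGaugeStep_mem_unitaryUnits (κ j) _ _ hc hi
        (fun i => hStairU gJ u₁ W A c₁ c' hInAk hInAx h137 h129 hSU hR1 hc'0 hwin hexp hchart hRestr j hj w ((hQ (j + 1) w).1 hw) i)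
        (fun i => (hStair gJ u₁ W A c₁ c' hInAk hInAx h137 h129 hSU hR1 hc'0 hwin hexp hchart hRestr j hj w ((hQ (j + 1) w).1 hw) i).trans (hh1 j))
        (fun i => (hosc i).trans ?_)
      have := hω1 j; have := hE1 j hj.le; linarith)
    (by -- hinit
      intro x _
      rw [congrFun hκ0 x, hA0, Units.mul_inv, sub_self, norm_zero]
      exact hE0)
    hE
  -- ## the top: `A_k = 1` on `Q_k`, so `‖κ_k − 1‖ ≤ E_k ≤ θG`
  have hfin : ∀ w, Q (K - n) w →
      ‖((κ (K - n) (coverAt (F.P K) (K - n) w) : (Matrix (Fin 2) (Fin 2) ℂ)ˣ) : Matrix (Fin 2) (Fin 2) ℂ) - 1‖ ≤ θG := by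
    intro w hw
    have h := (hmain (K - n) le_rfl (coverAt (F.P K) (K - n) w) ⟨w, hw, rfl⟩).2
    rw [hAlab (K - n) le_rfl w hw, htop w hw, inv_one, inv_one, Units.val_one, mul_one] at h
    exact h.trans hθG
  refine ⟨?_, fun yc hyc => hfin yc ?_⟩
  · have h := hfin (fun μ => ((iterBlockOf (K - n) x₀ μ).val : ℤ)) ?_
    · rwa [coverAt_valLift] at h
    · rw [hQ, Nat.sub_self]
      exact HalvingEffGaugeRowGLabels.inBox_valLift_iterBlockOf x₀ ha
  · rw [hQ, Nat.sub_self, HalvingEffGaugeRowGLabels.inBox_top_iff_mem_cubeLamS]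
    exact hyc

end Summit.QuantumFields.YangMills.Theorems.HalvingEffGaugeRowG

end
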